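import Literature.NumberTheory.Automorphic.Liu2021.SplitPlaceOscillatorModelExplicit
import Literature.NumberTheory.Automorphic.PrincipalSeriesGL2SatakeParametersLastBlock
import Literature.NumberTheory.Automorphic.AdicCompletionLocalField
import HarnessLib

/-!
# [Liu2021, Lemma D.1 (2)] at a split place, `N = 2`: the Satake parameters of the local theta quotient, explicit

Topic `Literature/NumberTheory/Automorphic/Liu2021`; proof file (one theorem: no definition, no named fact, no instance).
The split-place model with explicit characters (`splitPlace_chiCoinv_iso_parabolicIndGL_explicit`,
`SplitPlaceOscillatorModelExplicit`: for a split place `v` of `F`, `w ∣ v`, a smooth unitary section `s` of `U(J)(F_v)`, a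
mixed-model pair `(Γ, η)` of `ω_s` with `η(κ_a) = νK(det a)`, and the characters `ν` (`ν ∘ ι_w = νK`) and `χ′` (`χ′(z_w) = χ(z)`)
of `E_wˣ`, the `χ`-coinvariants of `ω_s` under the centre, read on `GL_N(E_w)` along `localPiSplitEquiv`, are
`AreIsomorphicRep` to `Ind_{Q_{(N-1,1)}}^{GL_N}((ν∘det) ⊠ χ′ν^{1-N})`) is composed, at `N = 2`, with the Satake computation for
that induced representation (`isSatakeParameter_of_equiv_parabolicIndGL_lastBlockLabel_two`,
`PrincipalSeriesGL2SatakeParametersLastBlock`; Cartier §IV (4.2), Bump Prop. 4.6.6):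

* `splitPlace_chiCoinv_isSatakeParameter_explicit` — **if moreover `ν` and `χ′` are unramified at `w`, then for every
  uniformizer `ϖ_w` of `E_w` the multiset `{ν(ϖ_w), χ′(ϖ_w)·ν(ϖ_w)⁻¹}` is a Satake parameter
  (`SatakeParametersGL.IsSatakeParameter`: a non-zero `GL₂(𝒪_w)`-fixed vector on which `T_w` acts by
  `q_w^{1/2}(a₁ + a₂)` and `S_w` by `a₁a₂`) of the `χ`-coinvariant representation of `GL₂(E_w)`.**

This is [Liu2021, Lem. D.1 (2)] («`θ(χ_v, 1_v)` is the unramified constituent of `Ind(μ_v ⊠ χ̌_v μ_v^{-1,c})`») read at a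
split place as a statement about Hecke eigenvalues (print p. 126, first paragraph of the proof; the Satake numbers as in
Cartier (4.2)).  The global→local passage (reading the level-`K` operators `T_w, S_w` on `ω(μ, ε, χ)^K` through this local
model) and the identification of `νK` with the `w`-component of `μ` (print l. 5241) are NOT made here: they are the
remaining sockets of the d6 line of cell hodgecm-mathlib (census `CENSUS-D6-S4c-G-moduloS4b3`).

## References

* Y. Liu, *Fourier–Jacobi cycles and arithmetic relative trace formula*, Cambridge J. Math. 9 (2021), App. D,
  Lemma D.1 (2) and its proof, p. 126. [Liu2021]
* C. Mœglin, M.-F. Vignéras, J.-L. Waldspurger, LNM 1291 (1987), Chap. 3, III.7. [MoeglinVignerasWaldspurger1987]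
* P. Cartier, *Representations of 𝔭-adic groups: a survey*, PSPM 33 (1979), part 1, §IV (4.2). [CartierCorvallis1979]
* D. Bump, *Automorphic forms and representations* (1997), Prop. 4.6.6. [Bump1997]
-/

set_option autoImplicit false

noncomputable section

open NumberField IsDedekindDomain Matrix
open _root_.MeasureTheory
open scoped MatrixGroups
open ValuativeRel
open Literature.RepresentationTheory (TwistedCoinv.rep TwistedCoinv.Coinv TwistedCoinv.mk)
open Literature.RepresentationTheory.HeisenbergGroup (MpPsi leviOpPi)
open Literature.RepresentationTheory.HeisenbergGroup.SymplecticMatrix (glEquiv)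
open Literature.NumberTheory.GelbartRogawski1991.UnitaryDualPair.LocalSplitting (iota LocalMp localSchrodinger)
open Literature.NumberTheory.Automorphic.Zelevinsky1980 (lastBlockLabel maxParabolicLeviChar)
open Literature.NumberTheory.Automorphic.UnitaryGroup

namespace Literature.NumberTheory.Automorphic.Liu2021

/-- An `AreIsomorphicRep` witness is a `Representation.Equiv`. [folklore] -/
private theorem nonempty_equiv_of_areIsomorphicRep {G : Type*} [Group G] {V₁ V₂ : Type*} [AddCommGroup V₁] [Module ℂ V₁]
    [AddCommGroup V₂] [Module ℂ V₂] {ρ₁ : Representation ℂ G V₁} {ρ₂ : Representation ℂ G V₂}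
    (h : AreIsomorphicRep ρ₁ ρ₂) : Nonempty (ρ₁.Equiv ρ₂) := by
  obtain ⟨f, hf⟩ := h
  exact ⟨Representation.Equiv.mk f fun g => LinearMap.ext fun x => hf g x⟩

set_option maxHeartbeats 2000000 in -- as in `SplitPlaceOscillatorModelExplicit`: instantiating its ≈ 40 heavy binders (`SchwartzBruhat`, `U(J)(F_v)`, `GL₂(E_w)` instance paths) at `N := 2` costs ≈ 1M heartbeats of `isDefEq`; the proof itself is 3 lines
/-- **[Liu2021, Lem. D.1 (2)] at a split place, `N = 2`, explicit form: the Satake parameters of the local theta quotient are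
`{ν(ϖ_w), χ′(ϖ_w)ν(ϖ_w)⁻¹}`.**  Data and hypotheses: those of `splitPlace_chiCoinv_iso_parabolicIndGL_explicit` at `N := 2`
(split place `v`, `w ∣ v` with `c • w ≠ w`, smooth unitary section `s`, hermitian line `J₁`, unitary continuous central
character `χ`, a mixed-model pair `(Γ, η)` of `ω_s` with `η(κ_a) = νK(det a)`, `ν ∘ ι_w = νK`, `χ′(z_w) = χ(z)`), PLUS: `ν` and
`χ′` unramified at `w` (trivial on the units of `𝒪_w`) and a uniformizer `ϖ_w` of `E_w`.  Conclusion: `{ν(ϖ_w), χ′(ϖ_w)·ν(ϖ_w)⁻¹}`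
is a Satake parameter of the representation of `GL₂(E_w)` (along `localPiSplitEquiv`) on the `χ`-coinvariants of `ω_s` under
the centre `U(J₁)(F_v)`.  Proof: the `AreIsomorphicRep` witness of the explicit model is a `Representation.Equiv`; apply
`isSatakeParameter_of_equiv_parabolicIndGL_lastBlockLabel_two`.
[cite: Liu2021, App. D, Lemma D.1 (2) and proof of Lemma D.1 (first paragraph), p. 126]
[cite: CartierCorvallis1979, §IV (4.2)] -/
theorem splitPlace_chiCoinv_isSatakeParameter_explicit
    (F : Type) [Field F] [NumberField F] (E : Type) [Field E] [NumberField E] [Algebra F E]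
    [Algebra.IsQuadraticExtension F E] (c : E ≃ₐ[F] E) (hc1 : c ≠ 1) (δ : E) (hcδ : c δ = -δ)
    (hδ : δ ≠ 0) (d : F) (hd : δ * δ = algebraMap F E d) (T : Matrix (Fin 2) (Fin 2) F) (hT : T.IsSymm) (hTd : IsUnit T.det)
    (J : Matrix (Fin 2) (Fin 2) E) (hJ : J = T.map (algebraMap F E)) (hJh : (J.map c)ᵀ = J)
    (v : HeightOneSpectrum (𝓞 F)) (w : UnitaryGroup.PlacesOver E v) (hw : c • (w : HeightOneSpectrum (𝓞 E)) ≠ w)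
    (hJw : IsUnit (UnitaryGroup.placeForm J (w : HeightOneSpectrum (𝓞 E))))
    [MeasurableSpace (v.adicCompletion F)] [BorelSpace (v.adicCompletion F)]
    (μX : Measure (Fin 2 → v.adicCompletion F)) [μX.IsAddHaarMeasure]
    (s : UnitaryGroup.localPi E c 2 J v →* LocalMp F 2 T v)
    (hs : ∀ g, MpPsi.proj _ (s g) = iota F E c 2 hcδ hδ hd T hT hJ v g)
    (hsm : Representation.IsSmooth ((MpPsi.toRep (localSchrodinger F 2 T v)).comp s))
    (hsu : Representation.IsL2Isometric μX ((MpPsi.toRep (localSchrodinger F 2 T v)).comp s))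
    (J₁ : Matrix (Fin 1) (Fin 1) E) (hJ₁ : J₁ 0 0 ≠ 0)
    [LocallyCompactSpace (standardParabolicGL ((w : HeightOneSpectrum (𝓞 E)).adicCompletion E)
      (Zelevinsky1980.lastBlockLabel 2))]
    (μ' : Measure (v.adicCompletion F)) [μ'.IsAddHaarMeasure]
    (Γ : (SchwartzBruhat (Fin 2 → v.adicCompletion F)) ≃ₗ[ℂ] (SchwartzBruhat (Fin 2 → v.adicCompletion F)))
    (η : UnitaryGroup.localPi E c 2 J v →* ℂˣ)
    (hΓi : ∀ Φ : (SchwartzBruhat (Fin 2 → v.adicCompletion F)), SchwartzBruhat.l2NormSq (Measure.pi fun _ : Fin 2 => μ') (Γ Φ) =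
      SchwartzBruhat.l2NormSq (Measure.pi fun _ : Fin 2 => μ') Φ)
    (hmodel : ∀ (a : GL (Fin 2) (v.adicCompletion F)) (Φ : (SchwartzBruhat (Fin 2 → v.adicCompletion F))),
      (MpPsi.toRep (localSchrodinger F 2 T v)).comp s
          ((UnitaryGroup.localPiSplitEquiv c J hc1 hJh w hw hJw).symm (Matrix.GeneralLinearGroup.map (toPlace v w) a)) Φ =
        ((η ((UnitaryGroup.localPiSplitEquiv c J hc1 hJh w hw hJw).symm (Matrix.GeneralLinearGroup.map (toPlace v w) a)) : ℂˣ) :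
            ℂ) • Γ.symm (leviOpPi (glEquiv (GLn.contragredient a)) (Γ Φ)))
    (νK : (v.adicCompletion F)ˣ →* ℂˣ)
    (hη : ∀ a : GL (Fin 2) (v.adicCompletion F),
      η ((UnitaryGroup.localPiSplitEquiv c J hc1 hJh w hw hJw).symm (Matrix.GeneralLinearGroup.map (toPlace v w) a)) =
        νK (Matrix.GeneralLinearGroup.det a))
    (ν : ((w : HeightOneSpectrum (𝓞 E)).adicCompletion E)ˣ →* ℂˣ)
    (hν : ∀ t : (v.adicCompletion F)ˣ,
      ν (Units.map (toPlace v w : v.adicCompletion F →+* (w : HeightOneSpectrum (𝓞 E)).adicCompletion E).toMonoidHom t) = νK t)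
    (χ : UnitaryGroup.localPi E c 1 J₁ v →* ℂˣ) (hχu : ∀ z, ‖((χ z : ℂˣ) : ℂ)‖ = 1)
    (hχc : Continuous fun z => ((χ z : ℂˣ) : ℂ))
    (χ' : ((w : HeightOneSpectrum (𝓞 E)).adicCompletion E)ˣ →* ℂˣ)
    (hχ' : ∀ z : UnitaryGroup.localPi E c 1 J₁ v,
      χ' (Matrix.GeneralLinearGroup.det ((z : UnitaryGroup.LocalGLPi E 1 v) w)) = χ z)
    -- NEW w.r.t. the explicit model: unramified characters and a uniformizer of `E_w`
    (hνu : ∀ u : ((w : HeightOneSpectrum (𝓞 E)).adicCompletion E)ˣ,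
      valuation ((w : HeightOneSpectrum (𝓞 E)).adicCompletion E) (u : (w : HeightOneSpectrum (𝓞 E)).adicCompletion E) = 1 →
        ν u = 1)
    (hχ'u : ∀ u : ((w : HeightOneSpectrum (𝓞 E)).adicCompletion E)ˣ,
      valuation ((w : HeightOneSpectrum (𝓞 E)).adicCompletion E) (u : (w : HeightOneSpectrum (𝓞 E)).adicCompletion E) = 1 →
        χ' u = 1)
    {ϖ : (w : HeightOneSpectrum (𝓞 E)).adicCompletion E} (hϖ : IsUniformizingElement ϖ) :
    IsSatakeParameter
      ((TwistedCoinv.rep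
        (ρW := show Representation ℂ (UnitaryGroup.localPi E c 1 J₁ v) (SchwartzBruhat (Fin 2 → v.adicCompletion F)) from
          ((MpPsi.toRep (localSchrodinger F 2 T v)).comp s).comp (UnitaryGroup.localCenter E c 2 J J₁ hJ₁ v))
        χ ((MpPsi.toRep (localSchrodinger F 2 T v)).comp s)
        (fun g z => (show Commute g (UnitaryGroup.localCenter E c 2 J J₁ hJ₁ v z) from
          UnitaryGroup.localCenter_comm E c 2 J J₁ hJ₁ v z g).map ((MpPsi.toRep (localSchrodinger F 2 T v)).comp s))).comp
        (UnitaryGroup.localPiSplitEquiv c J hc1 hJh w hw hJw).symm.toMonoidHom)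
      (Units.mk0 ϖ hϖ.ne_zero)
      {((ν (Units.mk0 ϖ hϖ.ne_zero) : ℂˣ) : ℂ),
        ((χ' (Units.mk0 ϖ hϖ.ne_zero) : ℂˣ) : ℂ) * (((ν (Units.mk0 ϖ hϖ.ne_zero) : ℂˣ) : ℂ))⁻¹} := by
  obtain ⟨-, hiso⟩ := splitPlace_chiCoinv_iso_parabolicIndGL_explicit F E c hc1 2 le_rfl δ hcδ hδ d hd T hT hTd J hJ hJh v w
    hw hJw μX s hs hsm hsu J₁ hJ₁ μ' Γ η hΓi hmodel νK hη ν hν χ hχu hχc χ' hχ'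
  obtain ⟨e⟩ := nonempty_equiv_of_areIsomorphicRep hiso
  exact isSatakeParameter_of_equiv_parabolicIndGL_lastBlockLabel_two ν χ' hνu hχ'u hϖ e

end Literature.NumberTheory.Automorphic.Liu2021

end
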